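import Literature.AnabelianGeometry.SemiGraphs.TemperedPiPointSeqFibre
import Literature.AnabelianGeometry.SemiGraphs.TemperedPiDecompositionEdges
import Literature.AnabelianGeometry.SemiGraphs.TemperedVerticialInjective
import HarnessLib

/-!
# The fibre isomorphisms of a compatible point sequence; charts and point sequences ([SemiAnbd] Thm 3.7 (i)/(iii), pp. 40–41)

Mochizuki, *Semi-graphs of anabelioids*, Publ. RIMS **42** (2006) [MochizukiSemiAnbd2006], §3: the
proof of Prop. 3.6 (ii) p. 38 (`π₁^temp(𝒢) := lim_i Gal(𝒢_{∞,i}/𝒢)` acts on the fibres of tempered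
coverings) and Thm. 3.7 (i)/(iii) pp. 40–41 ("natural continuous injective outer homomorphism
`π̂₁(𝒢_v) ↪ π₁^temp(𝒢)`"; compatible systems of vertices / edges of the trees `𝒢_{∞,i}`; "such
images of '`π̂₁(𝒢_e)`'s'").

Sequel to `TemperedPiPointSeqFibre.lean` (seat abc-iut-L3-t8, row (β)-1: CHART HALF of the
identifications (I1)–(I3) of `TemperedLevelData.lean` for the constructed chart), generic over seat
abc-iut-L3-t9's `GaloisLevelData` and seat abc-iut-L3-t6's point sequences.  Proof-lane content:

* `PointSeq.fibreIso` — for a compatible point sequence `P` over `v` and a covering `T` whose components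
  over `v₀` are split by the levels, the bijection `P.fibre T : T_{v₀} → T_v` (injective by rigidity,
  surjective for connected `𝔾`, equivariant by `fibre_piAct`) as an ISOMORPHISM of `B^temp(Π_v)`
  `T_v ≅ B^temp(P.decompHom) (T_{v₀} with its π₁^temp-action)`, natural in `T`
  (`restrictV_map_comp_fibreIso_hom`) — the components of the natural isomorphism
  "restriction to `v` ≅ (fibre functor) ⋙ B^temp(P.decompHom)" making `P.decompHom` verticial;
* `TemperedPiChart.isoOfInverseIso` / `isoOfFunctorIso`, `isVerticialHom_iff_nonempty_functorIso`,
  `isEdgeHom_iff_nonempty_functorIso` — for ANY chart `c`, being verticial / an edge homomorphism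
  (defined through `c.equiv.inverse`) is equivalently a natural isomorphism
  `restrictV ≅ c.equiv.functor ⋙ B^temp(ψ)` (transport along the unit / counit of the equivalence);
* `piAct_cover_bp` — on the base point `bp n` of `𝒢_{∞,S n}` the group `π₁^temp` acts through
  `ρ_n` by INVERSE deck transformations: `γ · bp n = ρ_n(γ)⁻¹ (bp n)`;
* `exists_pointSeq_decompHom_eq` — conversely to `fibreIso`: a homomorphism `φ : Π_v → π₁^temp`
  admitting `Π_v`-equivariant maps `(𝒢_{∞,S n})_{v₀} → (𝒢_{∞,S n})_v` compatible with the covering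
  maps of the tower and with all deck transformations IS the decomposition homomorphism of a
  compatible point sequence (the images of the base points) — the core of "(I1): verticial ⇒ fixes
  a compatible vertex system";
* `EdgeSeq.gluePointSeq`, `decompHomE_eq_decompHom_comp_brHom` — an edge-point sequence over `e`
  glued along a branch `b : e → v` is a point sequence over `v`, and the edge decomposition
  homomorphism is the vertex one composed with `b_* : Π_e → Π_v` (so that edge decomposition
  homomorphisms are EDGE homomorphisms once vertex ones are verticial, `isEdgeHom_comp_brHom`).

Nothing here bears on [IUTchIII] Cor. 3.12.
-/

namespace Literature.AnabelianGeometry.SemiGraphs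

namespace ProfiniteSemiGraph

open CategoryTheory Topology

universe u

variable {𝒢 : ProfiniteSemiGraph.{u}}

/-! ### Charts: verticial / edge homomorphisms through `c.equiv.functor` -/

namespace TemperedPiChart

variable (c : TemperedPiChart 𝒢) {X : Type*} [Category X] {R : BTempCat 𝒢 ⥤ X} {K : BTemp c.G ⥤ X}

/-- Transport along the unit of the chart equivalence: `c.equiv.inverse ⋙ R ≅ K` gives
`R ≅ c.equiv.functor ⋙ K`. [cite: MochizukiSemiAnbd2006, Prop 3.6(ii) p.38] -/
noncomputable def isoOfInverseIso (i : c.equiv.inverse ⋙ R ≅ K) : R ≅ c.equiv.functor ⋙ K :=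
  (c.equiv.funInvIdAssoc R).symm ≪≫ Functor.isoWhiskerLeft c.equiv.functor i

/-- Transport along the counit of the chart equivalence: `R ≅ c.equiv.functor ⋙ K` gives
`c.equiv.inverse ⋙ R ≅ K`. [cite: MochizukiSemiAnbd2006, Prop 3.6(ii) p.38] -/
noncomputable def isoOfFunctorIso (i : R ≅ c.equiv.functor ⋙ K) : c.equiv.inverse ⋙ R ≅ K :=
  Functor.isoWhiskerLeft c.equiv.inverse i ≪≫ c.equiv.invFunIdAssoc K

end TemperedPiChart

/-- `ψ : Π_v → π₁^temp(𝒢)` is verticial for the chart `c` iff the restriction functor `S ↦ S_v` on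
`B^temp(𝒢)` is isomorphic to the chart functor followed by `B^temp(ψ)`.
[cite: MochizukiSemiAnbd2006, Thm 3.7(i) p.40] -/
theorem isVerticialHom_iff_nonempty_functorIso (c : TemperedPiChart 𝒢) (v : 𝒢.graph.Vertex)
    (ψ : 𝒢.Gv v →ₜ* c.G) :
    IsVerticialHom c v ψ ↔
      Nonempty (ObjectProperty.ι _ ⋙ restrictV 𝒢 v ≅ c.equiv.functor ⋙ BTemp.res ψ) :=
  ⟨fun ⟨i⟩ => ⟨c.isoOfInverseIso i⟩, fun ⟨i⟩ => ⟨c.isoOfFunctorIso i⟩⟩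

/-- `ψ : Π_e → π₁^temp(𝒢)` is an edge homomorphism for the chart `c` iff the restriction functor
`S ↦ S_e` on `B^temp(𝒢)` is isomorphic to the chart functor followed by `B^temp(ψ)`.
[cite: MochizukiSemiAnbd2006, Thm 3.7(iii) p.41] -/
theorem isEdgeHom_iff_nonempty_functorIso (c : TemperedPiChart 𝒢) (e : 𝒢.graph.Edge)
    (ψ : 𝒢.Ge e →ₜ* c.G) :
    IsEdgeHom c e ψ ↔
      Nonempty (ObjectProperty.ι _ ⋙ restrictE 𝒢 e ≅ c.equiv.functor ⋙ BTemp.res ψ) :=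
  ⟨fun ⟨i⟩ => ⟨c.isoOfInverseIso i⟩, fun ⟨i⟩ => ⟨c.isoOfFunctorIso i⟩⟩

namespace GaloisLevelData

variable (D : GaloisLevelData 𝒢) (h𝒢 : 𝒢.IsCountable)

/-! ### The action of `π₁^temp` on the base points of the tower -/

/-- The universal morphism of `𝒢_{∞,S n}` at its own base point is the identity (into the component
of `bp n`): `liftAt_{bp n} ≫ ι = 𝟙`. [cite: MochizukiSemiAnbd2006, Prop 3.6 p.38] -/
theorem liftAt_bp_comp_componentι (n : ℕ)
    (hn : (D.S n).Splits ((D.cover h𝒢 n).component (Sum.inl ⟨D.v₀, D.bp n⟩))) :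
    D.liftAt h𝒢 (D.cover h𝒢 n) (D.bp n) n hn ≫ (D.cover h𝒢 n).componentι (Sum.inl ⟨D.v₀, D.bp n⟩) =
      𝟙 (D.cover h𝒢 n) :=
  (D.eq_liftAt_comp_componentι h𝒢 (D.cover h𝒢 n) (D.bp n) n hn (𝟙 _) rfl).symm

/-- Splitting of the component of `bp n` by `S n` propagates to all higher levels.
[cite: MochizukiSemiAnbd2006, Prop 3.6 p.38] -/
theorem splits_component_bp_of_le {n N : ℕ} (hnN : n ≤ N)
    (hn : (D.S n).Splits ((D.cover h𝒢 n).component (Sum.inl ⟨D.v₀, D.bp n⟩))) :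
    (D.S N).Splits ((D.cover h𝒢 n).component (Sum.inl ⟨D.v₀, D.bp n⟩)) := by
  induction N, hnN using Nat.le_induction with
  | base => exact hn
  | succ k _ ih => exact CovObj.Splits.of_hom (D.g k) ih

/-- The action of `G_N = Aut(𝒢_{∞,S N})`, `N ≥ n`, on the base point of `𝒢_{∞,S n}` through the universal
morphism is by the INVERSE of the image deck transformation: `σ · bp n = (mapLE σ)⁻¹ (bp n)` — here for
`σ = ρ_N(γ)`. [cite: MochizukiSemiAnbd2006, Prop 3.6 p.38] -/
theorem actAt_cover_bp (n : ℕ)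
    (hn : (D.S n).Splits ((D.cover h𝒢 n).component (Sum.inl ⟨D.v₀, D.bp n⟩))) {N : ℕ} (hnN : n ≤ N)
    (hN : (D.S N).Splits ((D.cover h𝒢 n).component (Sum.inl ⟨D.v₀, D.bp n⟩))) (γ : D.temperedPi h𝒢) :
    D.actAt h𝒢 (D.cover h𝒢 n) (D.bp n) N hN (D.proj h𝒢 N γ) =
      (((D.proj h𝒢 n γ)⁻¹ : D.Gal h𝒢 n).hom.fV D.v₀).hom.hom (D.bp n) := by
  induction N, hnN using Nat.le_induction with
  | base =>
    change (((D.liftAt h𝒢 (D.cover h𝒢 n) (D.bp n) n hN).fV D.v₀).hom.hom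
      ((((D.proj h𝒢 n γ)⁻¹ : D.Gal h𝒢 n).hom.fV D.v₀).hom.hom (D.bp n))).1 = _
    exact congrArg (fun φ : D.cover h𝒢 n ⟶ D.cover h𝒢 n => (φ.fV D.v₀).hom.hom
      ((((D.proj h𝒢 n γ)⁻¹ : D.Gal h𝒢 n).hom.fV D.v₀).hom.hom (D.bp n)))
      (D.liftAt_bp_comp_componentι h𝒢 n hN)
  | succ k hk ih =>
    have hk' : (D.S k).Splits ((D.cover h𝒢 n).component (Sum.inl ⟨D.v₀, D.bp n⟩)) :=
      D.splits_component_bp_of_le h𝒢 hk hn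
    rw [← ih hk', ← D.step_proj h𝒢 k γ]
    exact D.actAt_succ h𝒢 (D.cover h𝒢 n) (D.bp n) k hk' (D.proj h𝒢 (k + 1) γ)

/-- **`π₁^temp(𝒢)` acts on the base point `bp n ∈ (𝒢_{∞,S n})_{v₀}` through `ρ_n` by inverse deck
transformations**: `γ · bp n = ρ_n(γ)⁻¹ (bp n)` (for any choice of splitting levels defining the action).
[cite: MochizukiSemiAnbd2006, Prop 3.6(ii) p.38] -/
theorem piAct_cover_bp (n : ℕ)
    (hn : (D.S n).Splits ((D.cover h𝒢 n).component (Sum.inl ⟨D.v₀, D.bp n⟩)))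
    (lev : ((D.cover h𝒢 n).SV D.v₀).obj.V → ℕ)
    (hlev : ∀ (s : ((D.cover h𝒢 n).SV D.v₀).obj.V) (m : ℕ), lev s ≤ m →
      (D.S m).Splits ((D.cover h𝒢 n).component (Sum.inl ⟨D.v₀, s⟩))) (γ : D.temperedPi h𝒢) :
    D.piAct h𝒢 (D.cover h𝒢 n) lev hlev γ (D.bp n) =
      (((D.proj h𝒢 n γ)⁻¹ : D.Gal h𝒢 n).hom.fV D.v₀).hom.hom (D.bp n) := by
  have hN : lev (D.bp n) ≤ max n (lev (D.bp n)) := le_max_right _ _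
  unfold piAct
  rw [← D.actAt_proj_eq h𝒢 (D.cover h𝒢 n) lev hlev (D.bp n) γ _ hN]
  exact D.actAt_cover_bp h𝒢 n hn (le_max_left _ _) _ γ

/-- The deck transformation `ρ_n(γ)` moves `bp n` to `γ⁻¹ · bp n`. [cite: MochizukiSemiAnbd2006, Prop 3.6(ii) p.38] -/
theorem proj_fV_bp (n : ℕ)
    (hn : (D.S n).Splits ((D.cover h𝒢 n).component (Sum.inl ⟨D.v₀, D.bp n⟩)))
    (lev : ((D.cover h𝒢 n).SV D.v₀).obj.V → ℕ)
    (hlev : ∀ (s : ((D.cover h𝒢 n).SV D.v₀).obj.V) (m : ℕ), lev s ≤ m →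
      (D.S m).Splits ((D.cover h𝒢 n).component (Sum.inl ⟨D.v₀, s⟩))) (γ : D.temperedPi h𝒢) :
    ((D.proj h𝒢 n γ).hom.fV D.v₀).hom.hom (D.bp n) = D.piAct h𝒢 (D.cover h𝒢 n) lev hlev γ⁻¹ (D.bp n) := by
  rw [D.piAct_cover_bp h𝒢 n hn lev hlev γ⁻¹, map_inv, inv_inv]

/-! ### Point sequences from equivariant fibre maps (core of (I1)) -/

/-- **A homomorphism `φ : Π_v → π₁^temp(𝒢)` with natural `Π_v`-equivariant fibre maps
`β n : (𝒢_{∞,S n})_{v₀} → (𝒢_{∞,S n})_v` is a decomposition homomorphism**: if the `β n` are compatible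
with the covering maps of the tower, commute with all deck transformations, and intertwine the
`π₁^temp`-action through `φ` with the `Π_v`-action, then the images `β n (bp n)` of the base points form
a compatible point sequence `P` with `P.decompHom = φ` (the components of `φ h` move `P.pt n` to
`h⁻¹ · P.pt n`; rigidity). [cite: MochizukiSemiAnbd2006, Thm 3.7(i) p.40] -/
theorem exists_pointSeq_decompHom_eq {v : 𝒢.graph.Vertex} (φ : 𝒢.Gv v →* D.temperedPi h𝒢)
    (β : ∀ n, ((D.cover h𝒢 n).SV D.v₀).obj.V → ((D.cover h𝒢 n).SV v).obj.V)
    (hstep : ∀ (n : ℕ) (s : ((D.cover h𝒢 (n + 1)).SV D.v₀).obj.V),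
      β n (((D.stepCover h𝒢 n).fV D.v₀).hom.hom s) = ((D.stepCover h𝒢 n).fV v).hom.hom (β (n + 1) s))
    (haut : ∀ (n : ℕ) (σ : D.Gal h𝒢 n) (s : ((D.cover h𝒢 n).SV D.v₀).obj.V),
      β n ((σ.hom.fV D.v₀).hom.hom s) = (σ.hom.fV v).hom.hom (β n s))
    (hn : ∀ n, (D.S n).Splits ((D.cover h𝒢 n).component (Sum.inl ⟨D.v₀, D.bp n⟩)))
    (lev : ∀ n, ((D.cover h𝒢 n).SV D.v₀).obj.V → ℕ)
    (hlev : ∀ (n : ℕ) (s : ((D.cover h𝒢 n).SV D.v₀).obj.V) (m : ℕ), lev n s ≤ m →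
      (D.S m).Splits ((D.cover h𝒢 n).component (Sum.inl ⟨D.v₀, s⟩)))
    (hequiv : ∀ (n : ℕ) (h : 𝒢.Gv v) (s : ((D.cover h𝒢 n).SV D.v₀).obj.V),
      β n (D.piAct h𝒢 (D.cover h𝒢 n) (lev n) (hlev n) (φ h) s) = ((D.cover h𝒢 n).SV v).obj.ρ h (β n s)) :
    ∃ P : D.PointSeq h𝒢 v, (∀ n, P.pt n = β n (D.bp n)) ∧ P.decompHom = φ := by
  let P : D.PointSeq h𝒢 v :=
    ⟨fun n => β n (D.bp n), fun n => by rw [← hstep n, D.stepCover_bp h𝒢 n]⟩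
  refine ⟨P, fun n => rfl, ?_⟩
  ext h
  refine (P.eq_decompHom (φ h) h fun n => ?_).symm
  change ((D.proj h𝒢 n (φ h)).hom.fV v).hom.hom (β n (D.bp n)) =
    ((D.cover h𝒢 n).SV v).obj.ρ h⁻¹ (β n (D.bp n))
  rw [← haut n, D.proj_fV_bp h𝒢 n (hn n) (lev n) (hlev n) (φ h), ← map_inv, hequiv n]

namespace PointSeq

variable {D h𝒢} {v : 𝒢.graph.Vertex} (P : D.PointSeq h𝒢 v) (hc : 𝒢.graph.IsConnected)

/-! ### The fibre isomorphisms -/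

section Fibre

variable (T : CovObj 𝒢) (lev : (T.SV D.v₀).obj.V → ℕ)
  (hlev : ∀ (s : (T.SV D.v₀).obj.V) (n : ℕ), lev s ≤ n →
    (D.S n).Splits (T.component (Sum.inl ⟨D.v₀, s⟩)))

/-- The fibre map of a compatible point sequence as a bijection `T_{v₀} ≃ T_v` (connected `𝔾`).
[cite: MochizukiSemiAnbd2006, Thm 3.7(i) p.40] -/
noncomputable def fibreEquiv : (T.SV D.v₀).obj.V ≃ (T.SV v).obj.V :=
  Equiv.ofBijective (P.fibre T lev hlev) ⟨P.fibre_injective T lev hlev, P.fibre_surjective T lev hlev hc⟩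

/-- `fibreEquiv` is `fibre`. [cite: MochizukiSemiAnbd2006, Thm 3.7(i) p.40] -/
theorem fibreEquiv_apply (s : (T.SV D.v₀).obj.V) : P.fibreEquiv hc T lev hlev s = P.fibre T lev hlev s := rfl

/-- `fibre (fibreEquiv⁻¹ x) = x`. [cite: MochizukiSemiAnbd2006, Thm 3.7(i) p.40] -/
theorem fibre_fibreEquiv_symm (x : (T.SV v).obj.V) :
    P.fibre T lev hlev ((P.fibreEquiv hc T lev hlev).symm x) = x :=
  (P.fibreEquiv hc T lev hlev).apply_symm_apply x

/-- **The fibre isomorphism of `B^temp(Π_v)`**: `T_v ≅ B^temp(P.decompHom)(T_{v₀})`, where `T_{v₀}`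
carries its `π₁^temp(𝒢)`-action (`fibreObj`) — the inverse of the equivariant bijection `P.fibre T`.
[cite: MochizukiSemiAnbd2006, Thm 3.7(i) p.40] -/
noncomputable def fibreIso :
    T.SV v ≅ (BTemp.res P.decompHomCont).obj (D.fibreObj h𝒢 T lev hlev) :=
  BTemp.isoOfEquiv (P.fibreEquiv hc T lev hlev).symm fun g x => by
    change (P.fibreEquiv hc T lev hlev).symm ((T.SV v).obj.ρ g x) =
      D.piAct h𝒢 T lev hlev (P.decompHom g) ((P.fibreEquiv hc T lev hlev).symm x)
    apply (P.fibreEquiv hc T lev hlev).injective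
    rw [Equiv.apply_symm_apply, fibreEquiv_apply, P.fibre_piAct, P.fibre_fibreEquiv_symm]

/-- The underlying map of `fibreIso` is `fibre⁻¹`. [cite: MochizukiSemiAnbd2006, Thm 3.7(i) p.40] -/
theorem fibreIso_hom_apply (x : (T.SV v).obj.V) :
    (P.fibreIso hc T lev hlev).hom.hom.hom x = (P.fibreEquiv hc T lev hlev).symm x := rfl

/-- The underlying map of `fibreIso⁻¹` is `fibre`. [cite: MochizukiSemiAnbd2006, Thm 3.7(i) p.40] -/
theorem fibreIso_inv_apply (s : (T.SV D.v₀).obj.V) :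
    (P.fibreIso hc T lev hlev).inv.hom.hom s = P.fibre T lev hlev s := rfl

/-- **Naturality of the fibre isomorphisms** in the covering: for `f : T ⟶ T'` the square with
`f_v` and `B^temp(P.decompHom)(f_{v₀})` commutes. [cite: MochizukiSemiAnbd2006, Prop 3.6(ii) p.38] -/
theorem restrictV_map_comp_fibreIso_hom {T' : CovObj 𝒢} (f : T ⟶ T') (lev' : (T'.SV D.v₀).obj.V → ℕ)
    (hlev' : ∀ (s : (T'.SV D.v₀).obj.V) (n : ℕ), lev' s ≤ n →
      (D.S n).Splits (T'.component (Sum.inl ⟨D.v₀, s⟩))) :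
    (restrictV 𝒢 v).map f ≫ (P.fibreIso hc T' lev' hlev').hom =
      (P.fibreIso hc T lev hlev).hom ≫
        (BTemp.res P.decompHomCont).map (D.fibreMap h𝒢 f lev hlev lev' hlev') := by
  apply ObjectProperty.hom_ext
  apply Action.Hom.ext
  apply ConcreteCategory.hom_ext
  intro x
  change (P.fibreEquiv hc T' lev' hlev').symm ((f.fV v).hom.hom x) =
    (f.fV D.v₀).hom.hom ((P.fibreEquiv hc T lev hlev).symm x)
  apply (P.fibreEquiv hc T' lev' hlev').injective
  rw [Equiv.apply_symm_apply, fibreEquiv_apply, P.fibre_map T lev hlev f lev' hlev',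
    P.fibre_fibreEquiv_symm]

end Fibre

end PointSeq

/-! ### Edge-point sequences glued along a branch -/

namespace EdgeSeq

variable {D h𝒢} {e : 𝒢.graph.Edge} (Q : D.EdgeSeq h𝒢 e) (hc : 𝒢.graph.IsConnected)
  (b : 𝒢.graph.Branch) (v : 𝒢.graph.Vertex) (hb : 𝒢.graph.abuts b = some v)
  (hbe : 𝒢.graph.edgeOf b = e)

/-- **Gluing an edge-point sequence along a branch**: for a branch `b` of `e` abutting to `v`, the glued
points `glue_b (t n) ∈ (𝒢_{∞,S n})_v` form a compatible point sequence over `v` (the covering maps of the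
tower commute with the gluings). [cite: MochizukiSemiAnbd2006, Thm 3.7(iii) p.41] -/
noncomputable def gluePointSeq : D.PointSeq h𝒢 v where
  pt n := ((D.cover h𝒢 n).glue b v hb).hom.hom.hom (hbe ▸ Q.pt n :)
  compat n := by
    subst hbe
    rw [← CovHom.glue_fE, Q.compat n]

/-- The points of the glued sequence. [cite: MochizukiSemiAnbd2006, Thm 3.7(iii) p.41] -/
theorem gluePointSeq_pt (Q : D.EdgeSeq h𝒢 (𝒢.graph.edgeOf b)) (n : ℕ) :
    (Q.gluePointSeq b v hb rfl).pt n = ((D.cover h𝒢 n).glue b v hb).hom.hom.hom (Q.pt n) := rfl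

/-- **The edge decomposition homomorphism is the vertex one composed with `b_*`**:
`Q.decompHomE = (glue_b Q).decompHom ∘ b_*` — the component of `decompHomE h` moves `t n` to `h⁻¹ · t n`,
hence moves `glue_b (t n)` to `b_*(h)⁻¹ · glue_b (t n)` (equivariance of the gluing), which characterises
`decompHom (b_* h)` (rigidity). [cite: MochizukiSemiAnbd2006, Thm 3.7(iii) p.41] -/
theorem decompHomE_eq_decompHom_comp_brHom (Q : D.EdgeSeq h𝒢 (𝒢.graph.edgeOf b)) :
    Q.decompHomE hc = (Q.gluePointSeq b v hb rfl).decompHom.comp (𝒢.brHom b v hb).toMonoidHom := by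
  ext h
  refine (Q.gluePointSeq b v hb rfl).eq_decompHom ((Q.decompHomE hc) h) (𝒢.brHom b v hb h) fun n => ?_
  rw [gluePointSeq_pt, ← CovHom.glue_fE, Q.proj_decompHomE_apply hc n h, CovObj.glue_ρ, map_inv]

/-- The continuous form: `Q.decompHomEcont = (glue_b Q).decompHomCont ∘ b_*`.
[cite: MochizukiSemiAnbd2006, Thm 3.7(iii) p.41] -/
theorem decompHomEcont_eq_comp (Q : D.EdgeSeq h𝒢 (𝒢.graph.edgeOf b)) :
    Q.decompHomEcont hc = (Q.gluePointSeq b v hb rfl).decompHomCont.comp (𝒢.brHom b v hb) := by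
  apply ContinuousMonoidHom.ext
  intro h
  exact DFunLike.congr_fun (Q.decompHomE_eq_decompHom_comp_brHom hc b v hb) h

end EdgeSeq

end GaloisLevelData

end ProfiniteSemiGraph

end Literature.AnabelianGeometry.SemiGraphs
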